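import Summits.QuantumFields.BalabanUV.Beta.EriceFlowEnclosureLimitTwoLoop
import Mathlib.Analysis.Complex.ExponentialBounds
import Mathlib.Analysis.PSeries

/-!
# Beta / EriceFlowEnclosureAsymptoticScalingWitness — ROW AS, NECESSITY SIDE, LEMMAS: the profile w(t) = t∕log t of the witness
# β(t) = −1 + t∕log t (clause (L) holds on ]0, 1∕8] with C = 1, (T) FAILS: β − β₀ = −t∕log(1∕t) is not β₂·t + O(t²) for any β₂), and
# the series fact the witness needs — Σ 1∕((n+1)·log(n+1)) DIVERGES (Cauchy condensation against the harmonic series) (β-flow team,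
# prover 1, unit `b2b-balaban-beta-bflow-p1`, gen 15; module P1 #39d, consumed by #39e `EriceFlowEnclosureAsymptoticScalingNecessity`;
# Mathlib `summable_condensed_iff_of_nonneg`, `Real.exp_one_lt_d9`)

HONEST FRAMING (page 1 of everything the β sub-cell writes): discharging `BetaPertH` makes Bałaban's UV stability UNCONDITIONAL — a
real constructive-QFT result; it is NOT the continuum limit and NOT the Clay problem.  HONEST DEPENDENCY (cell reorg 2026-08-19,
verbatim): «continuum YM on T⁴ ⇐ BetaPertH ∧ nine spine estimates (0/9 proved); BetaPertH ⇐ (D1) ∧ (D4) ∧ CAP+tail; G-an2-4 gates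
asym, D1 and NE2/3/4.»  THIS MODULE DISCHARGES NOTHING and cites nothing of Erice as a fact: elementary calculus about ONE explicit
real function and one textbook series; it exists only to keep #39e under the 400-line limit.

WHAT THIS FILE PROVES (0 sorry, 0 def; the chart is ]0, 1∕8], where log t ≤ −2):
§1 `log_le_neg_two` (t ∈ ]0, 1∕8] ⟹ log t ≤ −2), `profile_nonpos` (t∕log t ≤ 0), `profile_ge` (−t∕2 ≤ t∕log t),
   **`profile_sub_le`** (t′ ≤ t in the chart ⟹ 0 ≤ t′∕log t′ − t∕log t ≤ t − t′: the profile is DECREASING and 1-LIPSCHITZ),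
   `profile_abs_sub_le` (|t∕log t − t′∕log t′| ≤ |t − t′|), `profile_tendsto_zero` (t∕log t → 0 as t → 0⁺),
   `profile_at_inv` (−((1∕j)∕log(1∕j)) = (1∕j)∕log j), `profile_lower_at` (j ≥ 2: 1∕(6·(j+1)·log(j+1)) ≤ −((1∕(3(j+1)))∕log(1∕(3(j+1))))).
§2 **`not_summable_inv_mul_log`** (¬ Summable (n ↦ 1∕((n+1)·log(n+1)))), `tendsto_sum_inv_mul_log_atTop` (its partial sums → +∞).
   (The harmonic bound Σ_{i<m} 1∕(i+1) ≤ 1 + log m is Mathlib's `harmonic_le_one_add_log` via #33 `harmonic_cast_eq`, used inline in #39e;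
   as a stand-alone statement it is already `Literature.NumberTheory.LFunctions.Montgomery.sum_range_one_div_succ_le_log`.)
NOT CLAIMED: anything about Erice or [I]; these are service lemmas.
-/

namespace Summit.QuantumFields.BalabanUV.Beta.EriceFlowEnclosureAsymptoticScalingWitness

open Set Filter Topology

noncomputable section

/-! ## §1 The profile t ↦ t∕log t on ]0, 1∕8] -/

/-- On the chart ]0, 1∕8]: `log t ≤ −2` (`log 8 ≥ 2` from `exp 1 < 2.7182818286`; the inequality `2 ≤ log 8` itself is already in
the tree as `Literature.NumberTheory.Sieve.MoebiusRough.two_le_log_eight` — re-derived inline here to keep this file's imports light).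
[folklore] -/
theorem log_le_neg_two {t : ℝ} (ht : t ∈ Ioc (0 : ℝ) (1 / 8)) : Real.log t ≤ -2 := by
  have h8 : (2 : ℝ) ≤ Real.log 8 := by
    rw [Real.le_log_iff_exp_le (by norm_num)]
    have h1 := Real.exp_one_lt_d9
    have h0 : 0 < Real.exp 1 := Real.exp_pos 1
    have e : Real.exp 2 = Real.exp 1 * Real.exp 1 := by rw [← Real.exp_add]; norm_num
    rw [e]; nlinarith
  have h := Real.log_le_log ht.1 ht.2
  rw [one_div, Real.log_inv] at h
  linarith

/-- On the chart: `t∕log t ≤ 0`. [folklore] -/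
theorem profile_nonpos {t : ℝ} (ht : t ∈ Ioc (0 : ℝ) (1 / 8)) : t / Real.log t ≤ 0 :=
  div_nonpos_of_nonneg_of_nonpos ht.1.le (by linarith [log_le_neg_two ht])

/-- On the chart: `−t∕2 ≤ t∕log t` (so |t∕log t| ≤ t∕2 ≤ 1∕16). [folklore] -/
theorem profile_ge {t : ℝ} (ht : t ∈ Ioc (0 : ℝ) (1 / 8)) : -(t / 2) ≤ t / Real.log t := by
  have hL := log_le_neg_two ht
  have h2 : t / (-Real.log t) ≤ t / 2 := div_le_div_of_nonneg_left ht.1.le (by norm_num) (by linarith)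
  have e : t / Real.log t = -(t / (-Real.log t)) := by rw [div_neg, neg_neg]
  rw [e]; linarith

/-- **THE PROFILE IS DECREASING AND 1-LIPSCHITZ on the chart: for `t′ ≤ t`, `0 ≤ t′∕log t′ − t∕log t ≤ t − t′`.**  With L = −log t ≤
L′ = −log t′ (both ≥ 2): t∕L − t′∕L′ = (t − t′)∕L + t′·(L′ − L)∕(L·L′), and t′·(L′ − L) = t′·log(t∕t′) ≤ t − t′. [folklore] -/
theorem profile_sub_le {t t' : ℝ} (ht : t ∈ Ioc (0 : ℝ) (1 / 8)) (ht' : t' ∈ Ioc (0 : ℝ) (1 / 8)) (hle : t' ≤ t) :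
    0 ≤ t' / Real.log t' - t / Real.log t ∧ t' / Real.log t' - t / Real.log t ≤ t - t' := by
  have hL2 : Real.log t ≤ -2 := log_le_neg_two ht
  have hL2' : Real.log t' ≤ -2 := log_le_neg_two ht'
  set L : ℝ := -Real.log t with hLdef
  set L' : ℝ := -Real.log t' with hL'def
  have hL : 2 ≤ L := by rw [hLdef]; linarith
  have hL' : 2 ≤ L' := by rw [hL'def]; linarith
  have hLL' : L ≤ L' := by
    rw [hLdef, hL'def]; linarith [Real.log_le_log ht'.1 hle]
  have hLpos : 0 < L := by linarith
  have hL'pos : 0 < L' := by linarith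
  -- the identity
  have e : t' / Real.log t' - t / Real.log t = (t - t') / L + t' * (L' - L) / (L * L') := by
    have e1 : Real.log t = -L := by rw [hLdef, neg_neg]
    have e2 : Real.log t' = -L' := by rw [hL'def, neg_neg]
    rw [e1, e2]
    field_simp
    ring
  -- t′·(L′ − L) ≤ t − t′  (log(t∕t′) ≤ t∕t′ − 1)
  have hkey : t' * (L' - L) ≤ t - t' := by
    have hq : L' - L = Real.log (t / t') := by
      rw [hLdef, hL'def, Real.log_div ht.1.ne' ht'.1.ne']; ring
    have hlog : Real.log (t / t') ≤ t / t' - 1 := Real.log_le_sub_one_of_pos (div_pos ht.1 ht'.1)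
    rw [hq]
    calc t' * Real.log (t / t') ≤ t' * (t / t' - 1) := mul_le_mul_of_nonneg_left hlog ht'.1.le
      _ = t - t' := by rw [mul_sub, mul_one, mul_div_assoc', mul_div_cancel_left₀ t ht'.1.ne']
  rw [e]
  constructor
  · have h1 : 0 ≤ (t - t') / L := div_nonneg (sub_nonneg.mpr hle) hLpos.le
    have h2 : 0 ≤ t' * (L' - L) / (L * L') :=
      div_nonneg (mul_nonneg ht'.1.le (sub_nonneg.mpr hLL')) (mul_pos hLpos hL'pos).le
    linarith
  · have h1 : (t - t') / L ≤ (t - t') / 2 := div_le_div_of_nonneg_left (sub_nonneg.mpr hle) (by norm_num) hL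
    have h2 : t' * (L' - L) / (L * L') ≤ (t - t') / 4 := by
      rw [div_le_div_iff₀ (mul_pos hLpos hL'pos) (by norm_num : (0:ℝ) < 4)]
      have h4 : 4 ≤ L * L' := by nlinarith
      nlinarith [sub_nonneg.mpr hle, mul_nonneg ht'.1.le (sub_nonneg.mpr hLL')]
    linarith [sub_nonneg.mpr hle]

/-- `|t∕log t − t′∕log t′| ≤ |t − t′|` on the chart. [folklore] -/
theorem profile_abs_sub_le {t t' : ℝ} (ht : t ∈ Ioc (0 : ℝ) (1 / 8)) (ht' : t' ∈ Ioc (0 : ℝ) (1 / 8)) :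
    |t / Real.log t - t' / Real.log t'| ≤ |t - t'| := by
  rcases le_total t' t with h | h
  · obtain ⟨h0, h1⟩ := profile_sub_le ht ht' h
    rw [abs_sub_comm, abs_of_nonneg h0, abs_of_nonneg (sub_nonneg.mpr h)]; exact h1
  · obtain ⟨h0, h1⟩ := profile_sub_le ht' ht h
    rw [abs_of_nonneg h0, abs_sub_comm, abs_of_nonneg (sub_nonneg.mpr h)]; exact h1

/-- `t∕log t → 0` as t → 0⁺ (|t∕log t| ≤ t∕2 on the chart). [folklore] -/
theorem profile_tendsto_zero : Tendsto (fun t : ℝ => t / Real.log t) (𝓝[>] 0) (𝓝 0) := by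
  rw [Metric.tendsto_nhdsWithin_nhds]
  intro ε hε
  refine ⟨min (1 / 8) ε, lt_min (by norm_num) hε, ?_⟩
  intro t ht0 hdist
  have ht0' : 0 < t := ht0
  have htlt : t < min (1 / 8) ε := by rwa [Real.dist_eq, sub_zero, abs_of_pos ht0'] at hdist
  have ht : t ∈ Ioc (0 : ℝ) (1 / 8) := ⟨ht0', (htlt.trans_le (min_le_left _ _)).le⟩
  rw [Real.dist_eq, sub_zero, abs_of_nonpos (profile_nonpos ht)]
  have := profile_ge ht
  linarith [htlt.trans_le (min_le_right _ _)]

/-- At `t = 1∕j`: `−((1∕j)∕log(1∕j)) = (1∕j)∕log j`. [folklore] -/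
theorem profile_at_inv (j : ℝ) : -((1 / j) / Real.log (1 / j)) = (1 / j) / Real.log j := by
  rw [one_div, Real.log_inv, div_neg, neg_neg]

/-- At `t = 1∕(3(j+1))`, j ≥ 2: `1∕(6·(j+1)·log(j+1)) ≤ −((1∕(3(j+1)))∕log(1∕(3(j+1))))` (since `log(3(j+1)) ≤ 2·log(j+1)`). [folklore] -/
theorem profile_lower_at {j : ℕ} (hj : 2 ≤ j) :
    1 / (6 * ((j : ℝ) + 1) * Real.log ((j : ℝ) + 1)) ≤ -((1 / (3 * ((j : ℝ) + 1))) / Real.log (1 / (3 * ((j : ℝ) + 1)))) := by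
  have hj' : (2 : ℝ) ≤ j := by exact_mod_cast hj
  have hj1 : (0 : ℝ) < (j : ℝ) + 1 := by positivity
  have hlog1 : 0 < Real.log ((j : ℝ) + 1) := Real.log_pos (by linarith)
  rw [profile_at_inv]
  -- log (3(j+1)) ≤ 2 log (j+1)  ⟸  3(j+1) ≤ (j+1)²
  have hlog3 : Real.log (3 * ((j : ℝ) + 1)) ≤ 2 * Real.log ((j : ℝ) + 1) := by
    rw [← Real.log_rpow hj1, Real.log_le_log_iff (by positivity) (by positivity)]
    rw [show (2 : ℝ) = (2 : ℕ) by norm_num, Real.rpow_natCast]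
    nlinarith
  have hlog3pos : 0 < Real.log (3 * ((j : ℝ) + 1)) := Real.log_pos (by linarith)
  rw [div_div, div_le_div_iff₀ (by positivity) (by positivity)]
  nlinarith

/-! ## §2 Two series facts -/

/-- **Σ 1∕((n+1)·log(n+1)) DIVERGES** (Cauchy condensation: `2^k∕((2^k+1)·log(2^k+1)) ≥ 1∕(2·log 2·(k+1))`, and the harmonic series
diverges).  (At n = 0 the term is `1∕(1·log 1) = 1∕0 = 0` in Lean — harmless.) [folklore] -/
theorem not_summable_inv_mul_log : ¬ Summable (fun n : ℕ => 1 / (((n : ℝ) + 1) * Real.log ((n : ℝ) + 1))) := by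
  set F : ℕ → ℝ := fun n => 1 / (((n : ℝ) + 1) * Real.log ((n : ℝ) + 1)) with hF
  have hFnn : ∀ n, 0 ≤ F n := fun n =>
    div_nonneg zero_le_one (mul_nonneg (by positivity) (Real.log_nonneg (by linarith [(Nat.cast_nonneg n : (0:ℝ) ≤ n)])))
  have hFmono : ∀ ⦃m n : ℕ⦄, 0 < m → m ≤ n → F n ≤ F m := by
    intro m n hm hmn
    have hm' : (1 : ℝ) ≤ m := by exact_mod_cast hm
    have hmn' : (m : ℝ) ≤ n := by exact_mod_cast hmn
    have hlogm : 0 < Real.log ((m : ℝ) + 1) := Real.log_pos (by linarith)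
    have hlogmn : Real.log ((m : ℝ) + 1) ≤ Real.log ((n : ℝ) + 1) := Real.log_le_log (by linarith) (by linarith)
    exact one_div_le_one_div_of_le (mul_pos (by linarith) hlogm)
      (mul_le_mul (by linarith) hlogmn hlogm.le (by linarith))
  rw [← summable_condensed_iff_of_nonneg hFnn hFmono]
  -- condensed terms ≥ 1∕(2 log 2 (k+1))
  have hlog2 : 0 < Real.log 2 := Real.log_pos one_lt_two
  have hlow : ∀ k : ℕ, 1 / (2 * Real.log 2) * (1 / ((k : ℝ) + 1)) ≤ (2 : ℝ) ^ k * F (2 ^ k) := by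
    intro k
    have h2k : (1 : ℝ) ≤ (2 : ℝ) ^ k := one_le_pow₀ (by norm_num)
    have hcast : ((2 ^ k : ℕ) : ℝ) = (2 : ℝ) ^ k := by push_cast; ring
    simp only [hF, hcast]
    have hlogle : Real.log ((2 : ℝ) ^ k + 1) ≤ ((k : ℝ) + 1) * Real.log 2 := by
      have : Real.log ((2 : ℝ) ^ k + 1) ≤ Real.log ((2 : ℝ) ^ (k + 1)) :=
        Real.log_le_log (by positivity) (by rw [pow_succ]; linarith)
      rw [Real.log_pow] at this; push_cast at this; linarith
    have hlogpos : 0 < Real.log ((2 : ℝ) ^ k + 1) := Real.log_pos (by linarith)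
    rw [div_mul_div_comm, one_mul, mul_one_div, div_le_div_iff₀ (by positivity) (by positivity)]
    nlinarith [mul_le_mul_of_nonneg_left hlogle (by positivity : (0:ℝ) ≤ (2:ℝ) ^ k)]
  intro hsum
  have hharm : Summable (fun k : ℕ => 1 / (2 * Real.log 2) * (1 / ((k : ℝ) + 1))) :=
    Summable.of_nonneg_of_le (fun k => by positivity) hlow hsum
  have h1 : Summable (fun k : ℕ => 1 / ((k : ℝ) + 1)) :=
    (summable_mul_left_iff (by positivity : 1 / (2 * Real.log 2) ≠ 0)).mp hharm
  have h2 : Summable (fun k : ℕ => 1 / ((k + 1 : ℕ) : ℝ)) := h1.congr fun k => by push_cast; ring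
  exact Real.not_summable_one_div_natCast ((summable_nat_add_iff 1).mp h2)

/-- The partial sums of `1∕((n+1)·log(n+1))` tend to +∞. [folklore] -/
theorem tendsto_sum_inv_mul_log_atTop :
    Tendsto (fun N : ℕ => ∑ n ∈ Finset.range N, 1 / (((n : ℝ) + 1) * Real.log ((n : ℝ) + 1))) atTop atTop :=
  (not_summable_iff_tendsto_nat_atTop_of_nonneg fun n =>
    div_nonneg zero_le_one (mul_nonneg (by positivity)
      (Real.log_nonneg (by linarith [(Nat.cast_nonneg n : (0:ℝ) ≤ n)])))).mp not_summable_inv_mul_log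

end

end Summit.QuantumFields.BalabanUV.Beta.EriceFlowEnclosureAsymptoticScalingWitness
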